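import Mathlib

/-!
# Resonance avoidance (solo-blind, s34; paper §24.12 REMARK)

The zeroth-law statement quantifies over SOME sequence `ν_j → 0`.  Hence a construction that
works for every `ν` outside an exceptional ("resonant") set `Z ⊆ ℝ` still yields the required
sequence as soon as `Z` is small — here: countable (e.g. the zero set of a real-analytic
Fredholm determinant on `(0, ν₀]`, which is discrete).  This file records the elementary
real-analysis step: a countable set cannot contain an interval `(0, ε)`, so one can choose
`0 < ν_j < 1/(j+1)` avoiding `Z`, and then `ν_j → 0`.
-/

namespace Summit.AnomalousDissipation.AnomalousDissipation.Theorems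

open Filter Topology MeasureTheory

/-- A countable set of reals does not contain any nonempty open interval `(a, b)`. -/
theorem not_Ioo_subset_of_countable {Z : Set ℝ} (hZ : Z.Countable) {a b : ℝ} (hab : a < b) :
    ¬ (Set.Ioo a b ⊆ Z) := by
  intro h
  have h0 : volume (Set.Ioo a b) = 0 := measure_mono_null h (hZ.measure_zero volume)
  rw [Real.volume_Ioo] at h0
  have : (0 : ℝ) < b - a := sub_pos.mpr hab
  have h1 : ENNReal.ofReal (b - a) ≠ 0 := by
    rw [ne_eq, ENNReal.ofReal_eq_zero, not_le]; exact this
  exact h1 h0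

/-- In every interval `(0, ε)`, `ε > 0`, there is a point outside a given countable set. -/
theorem exists_mem_Ioo_nmem_of_countable {Z : Set ℝ} (hZ : Z.Countable) {ε : ℝ} (hε : 0 < ε) :
    ∃ ν, 0 < ν ∧ ν < ε ∧ ν ∉ Z := by
  by_contra hcon
  push Not at hcon
  apply not_Ioo_subset_of_countable hZ hε
  intro ν hν
  exact hcon ν hν.1 hν.2

/-- RESONANCE AVOIDANCE: given a countable exceptional set `Z ⊆ ℝ`, there is a sequence of
positive reals tending to `0` that avoids `Z`. -/
theorem exists_seq_pos_tendsto_zero_nmem {Z : Set ℝ} (hZ : Z.Countable) :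
    ∃ ν : ℕ → ℝ, (∀ j, 0 < ν j) ∧ (∀ j, ν j ∉ Z) ∧ Tendsto ν atTop (𝓝 0) := by
  have key : ∀ j : ℕ, ∃ ν, 0 < ν ∧ ν < 1 / ((j : ℝ) + 1) ∧ ν ∉ Z := fun j =>
    exists_mem_Ioo_nmem_of_countable hZ (by positivity)
  choose ν hν using key
  refine ⟨ν, fun j => (hν j).1, fun j => (hν j).2.2, ?_⟩
  apply squeeze_zero (fun j => (hν j).1.le) (fun j => (hν j).2.1.le)
  exact tendsto_one_div_add_atTop_nhds_zero_nat

/-- Variant with an upper barrier: the sequence can be taken inside `(0, ν₀)` for any `ν₀ > 0`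
(the regime where a perturbative construction is valid). -/
theorem exists_seq_pos_lt_tendsto_zero_nmem {Z : Set ℝ} (hZ : Z.Countable) {ν₀ : ℝ} (hν₀ : 0 < ν₀) :
    ∃ ν : ℕ → ℝ, (∀ j, 0 < ν j) ∧ (∀ j, ν j < ν₀) ∧ (∀ j, ν j ∉ Z) ∧ Tendsto ν atTop (𝓝 0) := by
  have key : ∀ j : ℕ, ∃ ν, 0 < ν ∧ ν < min ν₀ (1 / ((j : ℝ) + 1)) ∧ ν ∉ Z := fun j =>
    exists_mem_Ioo_nmem_of_countable hZ (lt_min hν₀ (by positivity))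
  choose ν hν using key
  refine ⟨ν, fun j => (hν j).1, fun j => lt_of_lt_of_le (hν j).2.1 (min_le_left _ _),
    fun j => (hν j).2.2, ?_⟩
  apply squeeze_zero (fun j => (hν j).1.le)
    (fun j => le_trans (hν j).2.1.le (min_le_right _ _))
  exact tendsto_one_div_add_atTop_nhds_zero_nat

end Summit.AnomalousDissipation.AnomalousDissipation.Theorems
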